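import Summits.MatrixMultiplication.OmegaCensus.DominoZ31StructFiveRowsB
import HarnessLib

/-!
# Structural part-`5` route at `p = 31`: rows `14`–`21` of the completeness check (file 3 of 4)

See `DominoZ31StructFiveRowsA.lean` (split rationale) and `DominoZ31Z31StructFiveCells.lean` (the cell theorems).  ω-census `pub-omega`, family (b3), seat
pub-omega-group gen 23; framing: lottery ticket, floor = certified bounds/negative ranges; NOT progress on ω.
-/

namespace Summit.MatrixMultiplication.OmegaCensus

open Finset ZpZpDomino Literature.Combinatorics.Additive

namespace ZpZpDomino

set_option maxHeartbeats 4000000 in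
/-- Row `b = 14` of the completeness check (`31²` lookups). [folklore] -/
theorem checkFiveRow_31_14 : checkFiveRow 31 ecZ31s5 tabTreeZ31s5 14 = true := by decide +kernel

set_option maxHeartbeats 4000000 in
/-- Row `b = 15` of the completeness check (`31²` lookups). [folklore] -/
theorem checkFiveRow_31_15 : checkFiveRow 31 ecZ31s5 tabTreeZ31s5 15 = true := by decide +kernel

set_option maxHeartbeats 4000000 in
/-- Row `b = 16` of the completeness check (`31²` lookups). [folklore] -/
theorem checkFiveRow_31_16 : checkFiveRow 31 ecZ31s5 tabTreeZ31s5 16 = true := by decide +kernel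

set_option maxHeartbeats 4000000 in
/-- Row `b = 17` of the completeness check (`31²` lookups). [folklore] -/
theorem checkFiveRow_31_17 : checkFiveRow 31 ecZ31s5 tabTreeZ31s5 17 = true := by decide +kernel

set_option maxHeartbeats 4000000 in
/-- Row `b = 18` of the completeness check (`31²` lookups). [folklore] -/
theorem checkFiveRow_31_18 : checkFiveRow 31 ecZ31s5 tabTreeZ31s5 18 = true := by decide +kernel

set_option maxHeartbeats 4000000 in
/-- Row `b = 19` of the completeness check (`31²` lookups). [folklore] -/
theorem checkFiveRow_31_19 : checkFiveRow 31 ecZ31s5 tabTreeZ31s5 19 = true := by decide +kernel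

set_option maxHeartbeats 4000000 in
/-- Row `b = 20` of the completeness check (`31²` lookups). [folklore] -/
theorem checkFiveRow_31_20 : checkFiveRow 31 ecZ31s5 tabTreeZ31s5 20 = true := by decide +kernel

set_option maxHeartbeats 4000000 in
/-- Row `b = 21` of the completeness check (`31²` lookups). [folklore] -/
theorem checkFiveRow_31_21 : checkFiveRow 31 ecZ31s5 tabTreeZ31s5 21 = true := by decide +kernel


end ZpZpDomino

end Summit.MatrixMultiplication.OmegaCensus
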